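import Literature.AlgebraicGeometry.Modules.ZeroSchemeOfSection
import Literature.AlgebraicGeometry.Modules.SheafHomPullbackIso
import Literature.AlgebraicGeometry.Modules.AdaptedFrame
import Literature.AlgebraicGeometry.Modules.PullbackAffineChart
import HarnessLib

/-!
# The universal property of the zero scheme `Z(t)` of a section (Fulton B.3.2 / EGA I 9.7.9)

Topic `Literature/AlgebraicGeometry/Modules`, namespace `Literature.AlgebraicGeometry.Modules`.  THEOREMS ONLY; no definition, no
named fact, no instance, no notation, no `sorry`.

★ `Modules/ZeroSchemeOfSection` constructs the zero scheme `Z(t) ↪ X` of a global section `t ∈ Γ(X, E)` (ideal sheaf = the image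
of `t^∨ : E^∨ → 𝒪_X`; in a frame, generated by the coordinates of `t`).  This file proves that `Z(t)` REPRESENTS the vanishing of
`t`: a morphism `g : T → X` factors through `Z(t)` iff the pulled-back section `η_g(t) ∈ Γ(T, g^*E)` (★ `unitSection`) vanishes —
the scheme-theoretic «vanishing locus of a section of a vector bundle is a closed condition», the elementary half of the
containment-locus / Weil-restriction statement (h6) of cell `hodgecm-mathlib` (price sheet v0.4 §5b (6); the projective-flat half
`Morphisms/ContainmentLocusClosed` consumes it with the cohomology-and-base-change heads of (h2); the general proper-flat form needs
PURITY — Raynaud–Gruson — and is NOT in the tree: named LACK).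

* §1 In a frame `e : 𝒪^I ≅ E|_W` (`I` finite): `η_g(s) = ∑ᵢ g^♯(λᵢ(s)) · η_g(bᵢ)` (`unitSection_eq_sum_coord`), the coordinates of
  `η_g(s)` in the pulled-back frame ★ `pullbackFrame g e` are `g^♯(λᵢ(s))` (★ `coord_pullbackFrame_unitSection`), hence
  **`unitSection_eq_zero_iff_forall_coord`**: `η_g(s) = 0 ↔ ∀ i, g^♯(λᵢ(s)) = 0` (restricted frames: ★ `coord_restrictTrivialisation`).
* §2 For `E` with a frame system (finite locally free) and `g : T → X`: `η_g(t) = 0` implies `g^♯` kills every value `μ_V(t|_V)`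
  of `t` (`app_sectionValue_eq_zero_of_unitSection_eq_zero`), so **`zeroSchemeIdeal_le_ker_of_unitSection_eq_zero`**:
  `𝓘_{Z(t)} ≤ ker g^♯` (Mathlib `Scheme.Hom.ker`); conversely, when `E^∨` is affine-localizing (★ `zeroSchemeIdeal_ideal`),
  `𝓘_{Z(t)} ≤ ker g^♯` implies `η_g(t) = 0` (`unitSection_eq_zero_of_zeroSchemeIdeal_le_ker`); together
  **`zeroSchemeIdeal_le_ker_iff`**.
* §3 **`exists_comp_zeroSchemeι_eq_iff`** — `g` factors through `Z(t) ↪ X` iff `η_g(t) = 0` (Mathlib `Scheme.Hom.toImage`,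
  `IdealSheafData.inclusion`, `Scheme.Hom.le_ker_comp`), uniquely (`existsUnique_comp_zeroSchemeι_eq_iff`; `Z(t) ↪ X` is a
  monomorphism); `unitSection_zeroSchemeι_eq_zero` (`t` dies on `Z(t)`); `unitSection_comp_eq_zero` (the vanishing locus is a
  subfunctor).

[Fulton1998] App. B.3.2 («`Z(s)` is defined in `U_i` by the ideal generated by `s_{i1}, …, s_{ir}`») / [EGA1] (9.7.9.1) (the
subscheme of zeros of a section and its functor of points) / [StacksProject, Tag 01R8]-style closed-subscheme factorisation
(Mathlib `Scheme.kerAdjunction`).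

HC_CM is proved only modulo the 7 printed citations until rung 0 closes; nothing here is about HC.

## References
* [Fulton1998] W. Fulton, *Intersection Theory*, 2nd ed. (1998), App. B.3.2, B.3.4 (PDF p. 410).
* [Hartshorne1977] R. Hartshorne, *Algebraic Geometry*, GTM 52 (1977), II Prop. 5.9 (PDF p. 146), II §5 p. 110.
* [StacksProject] The Stacks Project, Tag 01HP (closed subschemes and quasi-coherent ideals), Tag 01AK.
-/

noncomputable section

-- `TopCat.Presheaf`/`Scheme.Modules` are not reducible (as in Mathlib's `AlgebraicGeometry/Modules`).
set_option backward.isDefEq.respectTransparency false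

universe u

open CategoryTheory CategoryTheory.Limits AlgebraicGeometry TopologicalSpace Opposite

namespace Literature.AlgebraicGeometry.Modules

open Literature.AlgebraicGeometry.Motives

variable {X T : Scheme.{u}} (g : T ⟶ X) {E : X.Modules}

/-! ### §1 Pulled-back sections in a frame -/

section Frame

open scoped Classical

variable {W V : X.Opens} {I : Type u} (e : SheafOfModules.free I ≅ E.over W)

variable [Fintype I]

/-- **`η_g(s) = ∑ᵢ g^♯(λᵢ(s)) · η_g(bᵢ)`**: the pull-back of a section expanded in the pull-backs of the basis sections (basis
expansion `s = ∑ᵢ λᵢ(s) bᵢ`, ★ `eq_sum_coord_smul`; `η` additive and `g^♯`-semilinear, ★ `unitSection_sum`/`unitSection_smul`).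
[cite: Hartshorne1977, II §5 p. 110] -/
theorem unitSection_eq_sum_coord (s : Γ(E, W)) :
    unitSection g E W s = ∑ i, g.app W (coord e (𝟙 W) s i) • unitSection g E W (basisSection e i) := by
  conv_lhs => rw [eq_sum_coord_smul e (𝟙 W) s]
  rw [unitSection_sum]
  refine Finset.sum_congr rfl fun i _ => ?_
  rw [presheaf_map_id, unitSection_smul]

/-- **`η_g(s) = 0 ↔ ∀ i, g^♯(λᵢ(s)) = 0`** for a section `s` of `E` over a frame open `W` (`⇒`: read the coordinates of `η_g(s)` in
the pulled-back frame; `⇐`: the expansion `unitSection_eq_sum_coord`).  Fulton: «`Z(s)` is defined in `U_i` by the ideal generated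
by `s_{i1}, …, s_{ir}`» — on `T`-points. [cite: Fulton1998, B.3.2 (PDF p. 410)] -/
theorem unitSection_eq_zero_iff_forall_coord (s : Γ(E, W)) :
    unitSection g E W s = 0 ↔ ∀ i, g.app W (coord e (𝟙 W) s i) = 0 := by
  constructor
  · intro h i
    have hc := coord_pullbackFrame_unitSection g e (𝟙 W) s i
    rw [h, coord_def, appLE_zero_right] at hc
    exact hc.symm
  · intro h
    rw [unitSection_eq_sum_coord g e s]
    exact Finset.sum_eq_zero fun i _ => by rw [h i, zero_smul]

end Frame

/-! ### §2 `𝓘_{Z(t)} ≤ ker g^♯ ↔ η_g(t) = 0` -/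

section Ideal

/-- Restricting `t|_V` further gives `t|_W` (★ `resTop`). [cite: Fulton1998, B.3.2 (PDF p. 410)] -/
theorem map_resTop' (t : Γ(E, ⊤)) {V W : X.Opens} (i : W ⟶ V) :
    E.presheaf.map i.op (resTop E t V) = resTop E t W := by
  rw [resTop, resTop, ← CategoryTheory.comp_apply, ← Functor.map_comp, ← op_comp,
    Subsingleton.elim (i ≫ homOfLE le_top) (homOfLE le_top)]

/-- `η_g(t)|_{g⁻¹V} = η_g(t|_V)` (★ `unitSection_map`). [cite: Hartshorne1977, II §5 p. 110] -/
theorem unitSection_top_map (t : Γ(E, ⊤)) (V : X.Opens) :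
    ((Scheme.Modules.pullback g).obj E).presheaf.map (homOfLE (g.preimage_mono (le_top : V ≤ ⊤))).op
        (unitSection g E ⊤ t) = unitSection g E V (resTop E t V) := by
  rw [resTop, unitSection_map]
  rfl

/-- `g^♯` commutes with restriction: `g^♯_V(c)|_{g⁻¹W} = g^♯_W(c|_W)`. [cite: Hartshorne1977, II §5 p. 110] -/
theorem app_map_eq_map_app {V W : X.Opens} (i : W ⟶ V) (c : Γ(X, V)) :
    g.app W (X.presheaf.map i.op c) = T.presheaf.map (homOfLE (g.preimage_mono i.le)).op (g.app V c) := by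
  have h := ConcreteCategory.congr_hom (g.naturality i.op) c
  simp only [CategoryTheory.comp_apply] at h
  rw [h]
  rfl

/-- **`η_g(t) = 0` ⟹ `g^♯` kills every value of `t`**: for every open `V ⊆ X` and every local functional
`μ : E|_V → 𝒪_X|_V`, `g^♯_V(μ_V(t|_V)) = 0` (expand `μ_{V′}(t|_{V′}) = ∑ᵢ λᵢ(t|_{V′}) μ_{V′}(bᵢ)` on the frame opens `V′ ⊆ V ∩ U_x`,
★ `sectionValue_eq_sum_coord`, where `g^♯(λᵢ(t|_{V′})) = 0` by `unitSection_eq_zero_iff_forall_coord`; glue on `𝒪_T`).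
[cite: Fulton1998, B.3.2 and B.3.4 (PDF p. 410)] -/
theorem app_sectionValue_eq_zero_of_unitSection_eq_zero (F : FrameSystem E) (t : Γ(E, ⊤)) (h : unitSection g E ⊤ t = 0) (V : X.Opens)
    (μ : E.over V ⟶ (unitModule X).over V) : g.app V (sectionValue E t μ) = 0 := by
  classical
  -- the cover of `V` by the opens `V ⊓ U_x`
  let P : X → X.Opens := fun x => V ⊓ F.U x
  have hcov : g ⁻¹ᵁ V ≤ ⨆ x, g ⁻¹ᵁ P x := by
    intro y hy
    have hy' : g.base y ∈ (V : Set X) := hy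
    exact Opens.mem_iSup.mpr ⟨g.base y, show g.base y ∈ (V ⊓ F.U (g.base y) : X.Opens) from ⟨hy', F.mem _⟩⟩
  refine TopCat.Sheaf.eq_of_locally_eq' (T.sheaf : TopCat.Sheaf CommRingCat T) (fun x => g ⁻¹ᵁ P x) (g ⁻¹ᵁ V)
    (fun x => homOfLE (g.preimage_mono inf_le_left)) hcov _ _ fun x => ?_
  rw [map_zero]
  change T.presheaf.map (homOfLE (g.preimage_mono (inf_le_left : P x ≤ V))).op (g.app V (sectionValue E t μ)) = 0
  haveI : Fintype (F.I x) := Fintype.ofEquiv _ (F.enum x).symm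
  rw [← app_map_eq_map_app g (homOfLE (inf_le_left : P x ≤ V)), map_sectionValue,
    sectionValue_eq_sum_coord (F.frame x) t (homOfLE (inf_le_right : P x ≤ F.U x)), map_sum]
  refine Finset.sum_eq_zero fun i _ => ?_
  rw [map_mul]
  -- `g^♯(λᵢ(t|_{P x})) = 0` from `η_g(t) = 0` read in the restricted frame over `P x`
  have hη : unitSection g E (P x) (resTop E t (P x)) = 0 := by
    rw [← unitSection_top_map g t (P x), h, map_zero]
  have hc := (unitSection_eq_zero_iff_forall_coord g
    (SheafOfModules.restrictTrivialisation (R := X.ringCatSheaf) (homOfLE (inf_le_right : P x ≤ F.U x)) (F.frame x))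
    (resTop E t (P x))).mp hη i
  rw [coord_restrictTrivialisation, Category.id_comp] at hc
  rw [hc, zero_mul]

/-- **`η_g(t) = 0 ⟹ 𝓘_{Z(t)} ≤ ker g^♯`** (Mathlib `Scheme.Hom.ker`; the sections of `𝓘_{Z(t)}` over an affine `V` are values of
`t`, ★ `zeroSchemeIdeal_ideal_le`, all killed by `g^♯`, `app_sectionValue_eq_zero_of_unitSection_eq_zero`).  No hypothesis on
`E^∨`. [cite: Fulton1998, B.3.4 (PDF p. 410)] [cite: Hartshorne1977, II Prop. 5.9 (PDF p. 146)] -/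
theorem zeroSchemeIdeal_le_ker_of_unitSection_eq_zero (F : FrameSystem E) (t : Γ(E, ⊤)) (h : unitSection g E ⊤ t = 0) :
    zeroSchemeIdeal E t ≤ g.ker := by
  refine (Scheme.IdealSheafData.le_ofIdeals_iff).2 fun V => ?_
  refine (zeroSchemeIdeal_ideal_le E t V).trans ?_
  rw [sectionValueIdeal]
  refine Ideal.span_le.2 ?_
  rintro _ ⟨μ, rfl⟩
  exact app_sectionValue_eq_zero_of_unitSection_eq_zero g F t h V μ

/-- **`𝓘_{Z(t)} ≤ ker g^♯ ⟹ η_g(t) = 0`**, for `E^∨` affine-localizing (then the sections of `𝓘_{Z(t)}` over an affine `V`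
ARE the values of `t`, ★ `zeroSchemeIdeal_ideal`, and contain the coordinates `λᵢ(t|_V)`, ★ `coord_resTop_mem`): on every affine
`V` inside a frame open, `g^♯(λᵢ(t|_V)) = 0`, hence `η_g(t)|_{g⁻¹V} = 0` (`unitSection_eq_zero_iff_forall_coord`); glue in `g^*E`.
[cite: Fulton1998, B.3.2 and B.3.4 (PDF p. 410)] -/
theorem unitSection_eq_zero_of_zeroSchemeIdeal_le_ker (F : FrameSystem E) (hE : IsAffineLocalizing (dual E)) (t : Γ(E, ⊤))
    (h : zeroSchemeIdeal E t ≤ g.ker) : unitSection g E ⊤ t = 0 := by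
  classical
  -- the cover of `X` by the affine opens inside frame opens, and of `T` by their preimages
  let ι : Type u := Σ x : X, {V : X.affineOpens // (V : X.Opens) ≤ F.U x}
  have hcov : (g ⁻¹ᵁ (⊤ : X.Opens)) ≤ ⨆ p : ι, g ⁻¹ᵁ (p.2.1 : X.Opens) := by
    intro y _
    obtain ⟨_, ⟨V, hV, rfl⟩, hyV, hVU⟩ := X.isBasis_affineOpens.exists_subset_of_mem_open (F.mem (g.base y)) (F.U (g.base y)).2
    exact Opens.mem_iSup.mpr ⟨⟨g.base y, ⟨⟨V, hV⟩, hVU⟩⟩, hyV⟩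
  refine TopCat.Sheaf.eq_of_locally_eq'
    (⟨((Scheme.Modules.pullback g).obj E).presheaf, ((Scheme.Modules.pullback g).obj E).isSheaf⟩ : TopCat.Sheaf Ab T)
    (fun p : ι => g ⁻¹ᵁ (p.2.1 : X.Opens)) (g ⁻¹ᵁ ⊤) (fun p => homOfLE (g.preimage_mono le_top)) hcov _ _ fun p => ?_
  obtain ⟨x, V, hVU⟩ := p
  rw [map_zero]
  change ((Scheme.Modules.pullback g).obj E).presheaf.map (homOfLE (g.preimage_mono (le_top : (V : X.Opens) ≤ ⊤))).op
    (unitSection g E ⊤ t) = 0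
  haveI : Fintype (F.I x) := Fintype.ofEquiv _ (F.enum x).symm
  rw [unitSection_top_map g t V,
    unitSection_eq_zero_iff_forall_coord g (SheafOfModules.restrictTrivialisation (R := X.ringCatSheaf) (homOfLE hVU) (F.frame x))]
  intro i
  rw [coord_restrictTrivialisation, Category.id_comp]
  -- `λᵢ(t|_V) ∈ 𝓘_{Z(t)}(V) ≤ ker g^♯_V`
  have hmem : coord (F.frame x) (homOfLE hVU) (resTop E t V) i ∈ (zeroSchemeIdeal E t).ideal V := by
    rw [zeroSchemeIdeal_ideal hE t V]
    exact coord_resTop_mem (F.frame x) t (homOfLE hVU) i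
  have hker := (Scheme.IdealSheafData.le_ofIdeals_iff.1 h) V hmem
  exact hker

/-- **The zero scheme represents the vanishing of `t`, ideal form**: for `E` finite locally free (a frame system) with `E^∨`
affine-localizing and `g : T → X`, `𝓘_{Z(t)} ≤ ker g^♯ ↔ η_g(t) = 0`. [cite: Fulton1998, B.3.2 and B.3.4 (PDF p. 410)]
[cite: Hartshorne1977, II Prop. 5.9 (PDF p. 146)] -/
theorem zeroSchemeIdeal_le_ker_iff (F : FrameSystem E) (hE : IsAffineLocalizing (dual E)) (t : Γ(E, ⊤)) :
    zeroSchemeIdeal E t ≤ g.ker ↔ unitSection g E ⊤ t = 0 :=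
  ⟨unitSection_eq_zero_of_zeroSchemeIdeal_le_ker g F hE t, zeroSchemeIdeal_le_ker_of_unitSection_eq_zero g F t⟩

end Ideal

/-! ### §3 Factorisation through `Z(t) ↪ X` -/

section Factor

/-- **`g : T → X` factors through `Z(t)` iff `η_g(t) = 0`** (for `E` finite locally free with `E^∨` affine-localizing): the
functor of points of the zero scheme is the vanishing locus of `t` (Mathlib: a morphism factors through the closed subscheme of an
ideal sheaf `𝓘` iff `𝓘 ≤ ker g^♯` — `Scheme.Hom.toImage`, `IdealSheafData.inclusion`, `Scheme.Hom.le_ker_comp`).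
[cite: Fulton1998, B.3.2 (PDF p. 410)] [cite: Hartshorne1977, II Prop. 5.9 (PDF p. 146)] -/
theorem exists_comp_zeroSchemeι_eq_iff (F : FrameSystem E) (hE : IsAffineLocalizing (dual E)) (t : Γ(E, ⊤)) :
    (∃ g' : T ⟶ zeroScheme E t, g' ≫ zeroSchemeι E t = g) ↔ unitSection g E ⊤ t = 0 := by
  rw [← zeroSchemeIdeal_le_ker_iff g F hE t]
  constructor
  · rintro ⟨g', rfl⟩
    rw [← ker_zeroSchemeι E t]
    exact g'.le_ker_comp (zeroSchemeι E t)
  · intro h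
    refine ⟨g.toImage ≫ Scheme.IdealSheafData.inclusion h, ?_⟩
    rw [zeroSchemeι, Category.assoc, Scheme.IdealSheafData.inclusion_subschemeι]
    exact g.toImage_imageι

/-- **Unique factorisation**: `Z(t) ↪ X` is a closed immersion, hence a monomorphism, so the factorisation of
`exists_comp_zeroSchemeι_eq_iff` is unique — `Z(t)` REPRESENTS the subfunctor `T ↦ {g : T → X | η_g(t) = 0}`.
[cite: Fulton1998, B.3.2 (PDF p. 410)] [cite: Hartshorne1977, II Prop. 5.9 (PDF p. 146)] -/
theorem existsUnique_comp_zeroSchemeι_eq_iff (F : FrameSystem E) (hE : IsAffineLocalizing (dual E)) (t : Γ(E, ⊤)) :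
    (∃! g' : T ⟶ zeroScheme E t, g' ≫ zeroSchemeι E t = g) ↔ unitSection g E ⊤ t = 0 := by
  rw [← exists_comp_zeroSchemeι_eq_iff g F hE t]
  haveI := isClosedImmersion_zeroSchemeι E t
  refine ⟨fun h => h.exists, fun ⟨g', hg'⟩ => ⟨g', hg', fun g'' hg'' => ?_⟩⟩
  exact (cancel_mono (zeroSchemeι E t)).mp (hg''.trans hg'.symm)

/-- **`t` dies on its zero scheme**: `η_ι(t) = 0` for `ι : Z(t) ↪ X`. [cite: Fulton1998, B.3.2 (PDF p. 410)] -/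
theorem unitSection_zeroSchemeι_eq_zero (F : FrameSystem E) (hE : IsAffineLocalizing (dual E)) (t : Γ(E, ⊤)) :
    unitSection (zeroSchemeι E t) E ⊤ t = 0 :=
  (exists_comp_zeroSchemeι_eq_iff (zeroSchemeι E t) F hE t).mp ⟨𝟙 _, Category.id_comp _⟩

/-- **The vanishing locus is a subfunctor**: if `η_g(t) = 0` then `η_{h ≫ g}(t) = 0` for every `h : T′ → T` (no hypothesis on
`E`: `η_{h ≫ g} = h^*η_g` through Mathlib's `pullbackComp`, ★ `pullbackComp_hom_app_unitSection`).
[cite: Hartshorne1977, II §5 p. 110] -/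
theorem unitSection_comp_eq_zero {T' : Scheme.{u}} (h : T' ⟶ T) (t : Γ(E, ⊤)) (ht : unitSection g E ⊤ t = 0) :
    unitSection (h ≫ g) E ⊤ t = 0 := by
  rw [← pullbackComp_hom_app_unitSection g E h ⊤ t, ht]
  simp only [unitSection, map_zero]

/-- `zeroSchemeIdeal_le_ker_iff` for `E` finite locally free (★ `frameSystemOfIsFiniteLocallyFree`). [cite: Fulton1998, B.3.2 and B.3.4 (PDF p. 410)] -/
theorem zeroSchemeIdeal_le_ker_iff_of_isFiniteLocallyFree (hlf : IsFiniteLocallyFree E) (hE : IsAffineLocalizing (dual E))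
    (t : Γ(E, ⊤)) : zeroSchemeIdeal E t ≤ g.ker ↔ unitSection g E ⊤ t = 0 :=
  zeroSchemeIdeal_le_ker_iff g (frameSystemOfIsFiniteLocallyFree hlf) hE t

/-- `existsUnique_comp_zeroSchemeι_eq_iff` for `E` finite locally free: **the zero scheme of a section of a vector bundle represents
its vanishing locus**. [cite: Fulton1998, B.3.2 (PDF p. 410)] [cite: Hartshorne1977, II Prop. 5.9 (PDF p. 146)] -/
theorem existsUnique_comp_zeroSchemeι_eq_iff_of_isFiniteLocallyFree (hlf : IsFiniteLocallyFree E)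
    (hE : IsAffineLocalizing (dual E)) (t : Γ(E, ⊤)) :
    (∃! g' : T ⟶ zeroScheme E t, g' ≫ zeroSchemeι E t = g) ↔ unitSection g E ⊤ t = 0 :=
  existsUnique_comp_zeroSchemeι_eq_iff g (frameSystemOfIsFiniteLocallyFree hlf) hE t

end Factor

end Literature.AlgebraicGeometry.Modules

end
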